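import Mathlib
import Summits.NavierStokesRegularity.NavierStokesRegularity.Theorems.TaoLadderRungTwoBreakBlowupRigidityOneMixedDrainPairWake
import Summits.NavierStokesRegularity.NavierStokesRegularity.Theorems.TaoLadderRungTwoBreakBlowupRigidityOneEveryShellFires
import HarnessLib

/-!
# NO ROBUST BLOW-UP OF THE MIXED-DRAIN PAIR INSIDE ITS ORTHANT below `(1+ε₀)⁵ < 1 + (v/u)²`: the orthant wake floor of
  `…MixedDrainPairWake` gives ε₀-INDEPENDENT geometric decay `E_{>n} ≤ (1+(v/u)²)^{−n} E₀` of the transmitted energy, and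
  «every shell fires» along the maximal exact flow of a robust blow-up (`everyShellFires_of_noGlobalCascade`) is incompatible
  with it once `Λ² = (1+ε₀)⁵ < 1 + (v/u)²` — the cell's rung-2 break mechanism (BP-D: a spread-uniform wake fraction kills the
  cascade as the scale ratio shrinks) as a THEOREM on a concrete fixed-spread family, CONDITIONAL on the sign pattern
  (census item (MP) of K2(1) `TaoLadderRungTwoBreak.BlowupRigidityOne`, stmt-NavierStokesRegularity-20206; `--supports`)

MODEL lattice ODEs only (Tao 2016 §4 (4.3), Lemma 4.1 (4.5)–(4.10), Thm. 4.2 statement shape); nothing here is a statement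
about the Navier–Stokes equations; NO item is closed.  DEF-FREE; ROUTE-INDEPENDENT MODULE (no `Theses` import).

* `tailEnergy_le_geometric_mixedDrainPair` — exact inviscid flow of `M(u,v)` (`u, v > 0`) from a one-shell datum at shell `0`;
  if (S1) `a_{n−1}b_{n−1} ≥ 0` and (S2) `b_n(u a_{n+1} + v b_{n+1}) ≥ 0` hold on `[0,t]` for EVERY `n ≥ 1`, then for every `n`
  `E₀ − S_n(t) ≤ r^n (E₀ − S_0(t))`, `r = (1 + (v/u)²)⁻¹` (wake floor + `‖x_n‖² ≥ a_n² + b_n²`, induction);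
* `normSq_le_geometric_mixedDrainPair` — with (4.5)-regularity on every `[0,T']` (energy bound `partialEnergy_le_datumEnergy`):
  `‖x_k(t)‖² ≤ r^{k−1} E₀` for `k ≥ 1`, EVERY `t`: a shell profile decaying at a rate independent of ε₀;
* `not_noGlobalCascade_mixedDrainPair_of_orthant` — if `0 < u, v ≤ 1`, `(1+ε₀)⁵ < 1 + (v/u)²` and the sign pattern (S1)–(S2)
  holds along every exact flow of `M(u,v)` from `X₀` at shell `0` (an ORTHANT-INVARIANCE hypothesis on the datum — NOT
  generally true: the drain on `a_n` is not proportional to `a_n`), then `¬ NoGlobalCascade ε₀ M(u,v) X₀`: along the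
  maximal exact flow of a robust blow-up every shell fires, `1 < C_A T Λ^{k+1} ‖x_k(t_k)‖`, against
  `‖x_k‖² ≤ r^{k−1}E₀` and `Λ²r < 1`.

HONEST LABEL: a conditional non-blow-up theorem for one explicit table family (the condition is a sign pattern the dynamics
need not preserve); it isolates exactly what (MP) must control — the sign changes; no stub, crux, rung or summit is proved;
rung 0.
-/

noncomputable section

-- the summit and its single sub-problem share the name (CONVENTIONS §1)
set_option linter.dupNamespace false

open Set Filter Topology MeasureTheory
open scoped RealInnerProductSpace

namespace Summit.NavierStokesRegularity.NavierStokesRegularity.Theorems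

namespace BlowupRigidityOne

open Literature.Analysis.FluidPDE Literature.Analysis.FluidPDE.TaoCascade

/-- `‖x‖² ≥ x_0² + x_1²` for a shell vector of a four-mode family. [folklore] -/
theorem sq_add_sq_le_norm_sq_shellVec (X : Fin 4 → ℤ → ℝ → ℝ) (k : ℤ) (τ : ℝ) :
    X 0 k τ ^ 2 + X 1 k τ ^ 2 ≤ ‖shellVec X k τ‖ ^ 2 := by
  rw [EuclideanSpace.norm_eq, Real.sq_sqrt (Finset.sum_nonneg fun i _ => by positivity)]
  simp only [Fin.sum_univ_four, shellVec_apply, Real.norm_eq_abs, sq_abs]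
  nlinarith [sq_nonneg (X 2 k τ), sq_nonneg (X 3 k τ)]

/-- **GEOMETRIC DECAY OF THE TRANSMITTED ENERGY IN THE ORTHANT.**  Exact inviscid flow of `M(u,v)` (`u, v > 0`) from a
one-shell datum at shell `0`; if the sign pattern (S1)–(S2) holds on `[0,t]` for every shell `n ≥ 1`, then
`E₀ − S_n(t) ≤ (1 + (v/u)²)^{−n} (E₀ − S_0(t))` for every `n`.
[cite: Tao2016AveragedNS, §4 (4.3), Lemma 4.1 (4.8)–(4.10); cell vocabulary (census item (MP))] -/
theorem tailEnergy_le_geometric_mixedDrainPair {u v ε₀ T : ℝ} (hu : 0 < u) (hv : 0 < v) (hε : 0 < ε₀)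
    {X : Fin 4 → ℤ → ℝ → ℝ} {X₀ : Fin 4 → ℝ}
    (hder : ∀ i k, ∀ t ∈ Ico 0 T, HasDerivWithinAt (X i k) (quadTerm ε₀ (fun (i₁ i₂ i₃ : Fin 4) (μ : ℤ × ℤ × ℤ) => if μ = ((0 : ℤ), (0 : ℤ), (1 : ℤ)) then
        (if (i₁ = 0 ∧ i₂ = 1) ∨ (i₁ = 1 ∧ i₂ = 0) then (if i₃ = 0 then u else if i₃ = 1 then v else 0) else 0)
      else if μ = ((1 : ℤ), (0 : ℤ), (0 : ℤ)) then
        (if i₁ = 0 ∧ i₂ = 1 ∧ i₃ = 0 then -u else if i₁ = 1 ∧ i₂ = 1 ∧ i₃ = 0 then -v else 0)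
      else if μ = ((0 : ℤ), (1 : ℤ), (0 : ℤ)) then
        (if i₁ = 1 ∧ i₂ = 0 ∧ i₃ = 0 then -u else if i₁ = 1 ∧ i₂ = 1 ∧ i₃ = 0 then -v else 0) else 0) X i k t) (Ici 0) t)
    (hinit : ∀ i k, X i k 0 = if k = 0 then X₀ i else 0)
    (hlow : ∀ i k t, k < 0 → X i k t = 0)
    {t : ℝ} (ht : t ∈ Ico 0 T)
    (hS1 : ∀ n : ℕ, 1 ≤ n → ∀ τ ∈ Icc 0 t, 0 ≤ X 0 ((n : ℤ) - 1) τ * X 1 ((n : ℤ) - 1) τ)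
    (hS2 : ∀ n : ℕ, 1 ≤ n → ∀ τ ∈ Icc 0 t, 0 ≤ X 1 n τ * (u * X 0 ((n : ℤ) + 1) τ + v * X 1 ((n : ℤ) + 1) τ))
    (n : ℕ) :
    (∑ i, X₀ i ^ 2) - ∑ j ∈ Finset.range (n + 1), ‖shellVec X (j : ℤ) t‖ ^ 2 ≤
      ((1 + (v / u) ^ 2)⁻¹) ^ n * ((∑ i, X₀ i ^ 2) - ‖shellVec X 0 t‖ ^ 2) := by
  have hq : 0 < 1 + (v / u) ^ 2 := by positivity
  induction n with
  | zero => simp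
  | succ n ih =>
      have hw := tailEnergy_add_sq_le_wake_mixedDrainPair hu hv hε hder hinit hlow (n := n + 1) (by omega) ht
        (hS1 (n + 1) (by omega)) (hS2 (n + 1) (by omega))
      have hx := sq_add_sq_le_norm_sq_shellVec X ((n + 1 : ℕ) : ℤ) t
      rw [Finset.sum_range_succ] at hw ⊢
      push_cast at hw hx ⊢
      set S := ∑ j ∈ Finset.range (n + 1), ‖shellVec X (j : ℤ) t‖ ^ 2 with hS
      set N := ‖shellVec X ((n : ℤ) + 1) t‖ ^ 2 with hN
      set A := X 0 ((n : ℤ) + 1) t ^ 2 with hA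
      set B := X 1 ((n : ℤ) + 1) t ^ 2 with hB
      set E := ∑ i, X₀ i ^ 2 with hE
      set c := (v / u) ^ 2 with hc
      have hc0 : 0 ≤ c := sq_nonneg _
      have hA0 : 0 ≤ A := sq_nonneg _
      have hcA : 0 ≤ c * A := mul_nonneg hc0 hA0
      have hvu : c * (u / v) ^ 2 = 1 := by rw [hc]; field_simp
      have h1 : c * (E - (S + N) + A) ≤ B := by
        have := mul_le_mul_of_nonneg_left hw hc0
        rwa [← mul_assoc, hvu, one_mul] at this
      have hd1 : c * (E - (S + N) + A) = c * (E - (S + N)) + c * A := by ring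
      have hd2 : (1 + c) * (E - (S + N)) = (E - (S + N)) + c * (E - (S + N)) := by ring
      have hkey : (1 + c) * (E - (S + N)) ≤ E - S := by linarith
      have hY : E - (S + N) ≤ (E - S) / (1 + c) := (le_div_iff₀' hq).2 hkey
      calc E - (S + N) ≤ (E - S) / (1 + c) := hY
        _ = (1 + c)⁻¹ * (E - S) := by rw [div_eq_inv_mul]
        _ ≤ (1 + c)⁻¹ * (((1 + c)⁻¹) ^ n * (E - ‖shellVec X 0 t‖ ^ 2)) :=
            mul_le_mul_of_nonneg_left ih (inv_nonneg.2 hq.le)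
        _ = ((1 + c)⁻¹) ^ (n + 1) * (E - ‖shellVec X 0 t‖ ^ 2) := by ring

/-- **ε₀-INDEPENDENT GEOMETRIC SHELL PROFILE IN THE ORTHANT.**  With (4.5)-regularity on every `[0,T']`, `T' < T` (so the
partial energies are bounded by the datum energy), the orthant sign pattern on `[0,t]` gives `‖x_k(t)‖² ≤ r^{k−1} E₀` for every
`k ≥ 1`, `r = (1 + (v/u)²)⁻¹`.
[cite: Tao2016AveragedNS, §4 (4.3), Lemma 4.1 (4.5), (4.8)–(4.10); cell vocabulary (census item (MP))] -/
theorem normSq_le_geometric_mixedDrainPair {u v ε₀ T : ℝ} (hu : 0 < u) (hv : 0 < v) (hε : 0 < ε₀)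
    {X : Fin 4 → ℤ → ℝ → ℝ} {X₀ : Fin 4 → ℝ}
    (hder : ∀ i k, ∀ t ∈ Ico 0 T, HasDerivWithinAt (X i k) (quadTerm ε₀ (fun (i₁ i₂ i₃ : Fin 4) (μ : ℤ × ℤ × ℤ) => if μ = ((0 : ℤ), (0 : ℤ), (1 : ℤ)) then
        (if (i₁ = 0 ∧ i₂ = 1) ∨ (i₁ = 1 ∧ i₂ = 0) then (if i₃ = 0 then u else if i₃ = 1 then v else 0) else 0)
      else if μ = ((1 : ℤ), (0 : ℤ), (0 : ℤ)) then
        (if i₁ = 0 ∧ i₂ = 1 ∧ i₃ = 0 then -u else if i₁ = 1 ∧ i₂ = 1 ∧ i₃ = 0 then -v else 0)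
      else if μ = ((0 : ℤ), (1 : ℤ), (0 : ℤ)) then
        (if i₁ = 1 ∧ i₂ = 0 ∧ i₃ = 0 then -u else if i₁ = 1 ∧ i₂ = 1 ∧ i₃ = 0 then -v else 0) else 0) X i k t) (Ici 0) t)
    (hinit : ∀ i k, X i k 0 = if k = 0 then X₀ i else 0)
    (hlow : ∀ i k t, k < 0 → X i k t = 0)
    (hreg : ∀ T' : ℝ, T' < T → ∃ M : ℝ, ∀ t ∈ Icc 0 T', ∀ (i : Fin 4) (k : ℤ),
      (1 + (1 + ε₀) ^ ((10 : ℝ) * k)) * |X i k t| ≤ M)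
    {t : ℝ} (ht : t ∈ Ico 0 T)
    (hS1 : ∀ n : ℕ, 1 ≤ n → ∀ τ ∈ Icc 0 t, 0 ≤ X 0 ((n : ℤ) - 1) τ * X 1 ((n : ℤ) - 1) τ)
    (hS2 : ∀ n : ℕ, 1 ≤ n → ∀ τ ∈ Icc 0 t, 0 ≤ X 1 n τ * (u * X 0 ((n : ℤ) + 1) τ + v * X 1 ((n : ℤ) + 1) τ))
    {k : ℕ} (hk : 1 ≤ k) :
    ‖shellVec X (k : ℤ) t‖ ^ 2 ≤ ((1 + (v / u) ^ 2)⁻¹) ^ (k - 1) * ∑ i, X₀ i ^ 2 := by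
  have hq : 0 < 1 + (v / u) ^ 2 := by positivity
  have hc := isCancellingCoeff_mixedDrainPair u v
  have hE := partialEnergy_le_datumEnergy hε hc hder hinit hlow hreg t ht k
  have hgeo := tailEnergy_le_geometric_mixedDrainPair hu hv hε hder hinit hlow ht hS1 hS2 (k - 1)
  have hk1 : k - 1 + 1 = k := by omega
  rw [hk1] at hgeo
  rw [Finset.sum_range_succ] at hE
  have h0 : 0 ≤ ‖shellVec X 0 t‖ ^ 2 := sq_nonneg _
  have hr : 0 ≤ ((1 + (v / u) ^ 2)⁻¹) ^ (k - 1) := pow_nonneg (inv_nonneg.2 hq.le) _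
  nlinarith [mul_le_mul_of_nonneg_left (show (∑ i, X₀ i ^ 2) - ‖shellVec X 0 t‖ ^ 2 ≤ ∑ i, X₀ i ^ 2 by linarith) hr]

/-- **NO ROBUST BLOW-UP OF `M(u,v)` INSIDE ITS ORTHANT below `(1+ε₀)⁵ < 1 + (v/u)²`.**  Let `0 < u, v ≤ 1` (so
`M(u,v) ∈ E₂(max(u⁻¹, v⁻¹))`), `ε₀ > 0` with `(1+ε₀)⁵ < 1 + (v/u)²`, and a one-shell datum `X₀` such that EVERY exact inviscid
flow of `M(u,v)` from `X₀` at shell `0` keeps the sign pattern (S1) `a_{n−1}b_{n−1} ≥ 0`, (S2) `b_n(u a_{n+1}+v b_{n+1}) ≥ 0`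
(`n ≥ 1`).  Then `¬ NoGlobalCascade ε₀ M(u,v) X₀`: along the maximal exact flow of a robust blow-up every shell fires
(`everyShellFires_of_noGlobalCascade`: `1 < C_A T Λ^{k+1}‖x_k(t_k)‖`), while the orthant profile gives `‖x_k‖² ≤ r^{k−1}E₀`
with `Λ² r = (1+ε₀)⁵/(1+(v/u)²) < 1` — impossible for large `k`.
[cite: Tao2016AveragedNS, §4 Thm. 4.2 (statement shape), Lemma 4.1 (4.5)–(4.10); cell vocabulary (`NoGlobalCascade`, census item (MP), BP-D)] -/
theorem not_noGlobalCascade_mixedDrainPair_of_orthant {u v ε₀ : ℝ} (hu : 0 < u) (hu1 : u ≤ 1) (hv : 0 < v)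
    (hv1 : v ≤ 1) (hε : 0 < ε₀) (hth : (1 + ε₀) ^ 5 < 1 + (v / u) ^ 2) {X₀ : Fin 4 → ℝ}
    (horth : ∀ (T : ℝ) (X : Fin 4 → ℤ → ℝ → ℝ), 0 < T →
      (∀ i n, X i n 0 = if n = 0 then X₀ i else 0) → (∀ i n t, n < 0 → X i n t = 0) →
      (∀ i k, ∀ τ ∈ Ico (0 : ℝ) T, HasDerivWithinAt (X i k) (quadTerm ε₀ (fun (i₁ i₂ i₃ : Fin 4) (μ : ℤ × ℤ × ℤ) => if μ = ((0 : ℤ), (0 : ℤ), (1 : ℤ)) then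
        (if (i₁ = 0 ∧ i₂ = 1) ∨ (i₁ = 1 ∧ i₂ = 0) then (if i₃ = 0 then u else if i₃ = 1 then v else 0) else 0)
      else if μ = ((1 : ℤ), (0 : ℤ), (0 : ℤ)) then
        (if i₁ = 0 ∧ i₂ = 1 ∧ i₃ = 0 then -u else if i₁ = 1 ∧ i₂ = 1 ∧ i₃ = 0 then -v else 0)
      else if μ = ((0 : ℤ), (1 : ℤ), (0 : ℤ)) then
        (if i₁ = 1 ∧ i₂ = 0 ∧ i₃ = 0 then -u else if i₁ = 1 ∧ i₂ = 1 ∧ i₃ = 0 then -v else 0) else 0) X i k τ) (Ici 0) τ) →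
      ∀ n : ℕ, 1 ≤ n → ∀ τ ∈ Ico (0 : ℝ) T,
        0 ≤ X 0 ((n : ℤ) - 1) τ * X 1 ((n : ℤ) - 1) τ ∧
          0 ≤ X 1 n τ * (u * X 0 ((n : ℤ) + 1) τ + v * X 1 ((n : ℤ) + 1) τ)) :
    ¬ NoGlobalCascade ε₀ (fun (i₁ i₂ i₃ : Fin 4) (μ : ℤ × ℤ × ℤ) => if μ = ((0 : ℤ), (0 : ℤ), (1 : ℤ)) then
        (if (i₁ = 0 ∧ i₂ = 1) ∨ (i₁ = 1 ∧ i₂ = 0) then (if i₃ = 0 then u else if i₃ = 1 then v else 0) else 0)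
      else if μ = ((1 : ℤ), (0 : ℤ), (0 : ℤ)) then
        (if i₁ = 0 ∧ i₂ = 1 ∧ i₃ = 0 then -u else if i₁ = 1 ∧ i₂ = 1 ∧ i₃ = 0 then -v else 0)
      else if μ = ((0 : ℤ), (1 : ℤ), (0 : ℤ)) then
        (if i₁ = 1 ∧ i₂ = 0 ∧ i₃ = 0 then -u else if i₁ = 1 ∧ i₂ = 1 ∧ i₃ = 0 then -v else 0) else 0) X₀ := by
  intro hNG
  -- `M(u,v) ∈ E₂(R)` with `R = max u⁻¹ v⁻¹`
  have hα : InTableClass (max u⁻¹ v⁻¹) (fun (i₁ i₂ i₃ : Fin 4) (μ : ℤ × ℤ × ℤ) => if μ = ((0 : ℤ), (0 : ℤ), (1 : ℤ)) then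
        (if (i₁ = 0 ∧ i₂ = 1) ∨ (i₁ = 1 ∧ i₂ = 0) then (if i₃ = 0 then u else if i₃ = 1 then v else 0) else 0)
      else if μ = ((1 : ℤ), (0 : ℤ), (0 : ℤ)) then
        (if i₁ = 0 ∧ i₂ = 1 ∧ i₃ = 0 then -u else if i₁ = 1 ∧ i₂ = 1 ∧ i₃ = 0 then -v else 0)
      else if μ = ((0 : ℤ), (1 : ℤ), (0 : ℤ)) then
        (if i₁ = 1 ∧ i₂ = 0 ∧ i₃ = 0 then -u else if i₁ = 1 ∧ i₂ = 1 ∧ i₃ = 0 then -v else 0) else 0) := by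
    refine inTableClass_mixedDrainPair ?_ ?_ ?_ ?_
    · rw [abs_of_pos hu]
      calc (max u⁻¹ v⁻¹)⁻¹ ≤ (u⁻¹)⁻¹ := inv_anti₀ (inv_pos.2 hu) (le_max_left _ _)
        _ = u := inv_inv u
    · rw [abs_of_pos hu]; exact hu1
    · rw [abs_of_pos hv]
      calc (max u⁻¹ v⁻¹)⁻¹ ≤ (v⁻¹)⁻¹ := inv_anti₀ (inv_pos.2 hv) (le_max_right _ _)
        _ = v := inv_inv v
    · rw [abs_of_pos hv]; exact hv1
  obtain ⟨T, X, hT, h1, h2, h3, h4, h5, hfire, -⟩ := everyShellFires_of_noGlobalCascade hε hα hNG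
  -- one-sided derivatives and regularity in the form of `…EnergyBound`
  have hder : ∀ i k, ∀ τ ∈ Ico (0 : ℝ) T,
      HasDerivWithinAt (X i k) (quadTerm ε₀ (fun (i₁ i₂ i₃ : Fin 4) (μ : ℤ × ℤ × ℤ) => if μ = ((0 : ℤ), (0 : ℤ), (1 : ℤ)) then
        (if (i₁ = 0 ∧ i₂ = 1) ∨ (i₁ = 1 ∧ i₂ = 0) then (if i₃ = 0 then u else if i₃ = 1 then v else 0) else 0)
      else if μ = ((1 : ℤ), (0 : ℤ), (0 : ℤ)) then
        (if i₁ = 0 ∧ i₂ = 1 ∧ i₃ = 0 then -u else if i₁ = 1 ∧ i₂ = 1 ∧ i₃ = 0 then -v else 0)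
      else if μ = ((0 : ℤ), (1 : ℤ), (0 : ℤ)) then
        (if i₁ = 1 ∧ i₂ = 0 ∧ i₃ = 0 then -u else if i₁ = 1 ∧ i₂ = 1 ∧ i₃ = 0 then -v else 0) else 0) X i k τ) (Ici 0) τ := by
    intro i k τ hτ
    have hd : DifferentiableWithinAt ℝ (X i k) (Ico 0 T) τ :=
      ((h1 i k).differentiableOn one_ne_zero) τ hτ
    have hd' : DifferentiableWithinAt ℝ (X i k) (Ici 0) τ :=
      hd.mono_of_mem_nhdsWithin (by
        rw [mem_nhdsWithin]
        exact ⟨Iio T, isOpen_Iio, hτ.2, fun x hx => ⟨hx.2, hx.1⟩⟩)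
    rw [← h4 i k τ hτ.1 hτ.2]
    exact hd'.hasDerivWithinAt
  have hreg : ∀ T' : ℝ, T' < T → ∃ M : ℝ, ∀ τ ∈ Icc (0 : ℝ) T', ∀ (i : Fin 4) (k : ℤ),
      (1 + (1 + ε₀) ^ ((10 : ℝ) * k)) * |X i k τ| ≤ M := by
    intro T' hT'
    rcases le_or_gt T' 0 with h0 | h0
    · obtain ⟨M, hM⟩ := h5 (T / 2) (by linarith) (by linarith)
      exact ⟨M, fun τ hτ i k => hM τ hτ.1 (by linarith [hτ.2]) i k⟩
    · obtain ⟨M, hM⟩ := h5 T' h0 hT'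
      exact ⟨M, fun τ hτ i k => hM τ hτ.1 hτ.2 i k⟩
  have hsign := horth T X hT h2 h3 hder
  -- the orthant profile: `‖x_k(t)‖² ≤ r^{k-1} E₀` for `k ≥ 1`, all `t < T`
  set r : ℝ := (1 + (v / u) ^ 2)⁻¹ with hr
  set E₀ : ℝ := ∑ i, X₀ i ^ 2 with hE₀
  have hq : 0 < 1 + (v / u) ^ 2 := by positivity
  have hr0 : 0 < r := inv_pos.2 hq
  have hprof : ∀ k : ℕ, 1 ≤ k → ∀ t ∈ Ico (0 : ℝ) T, ‖shellVec X (k : ℤ) t‖ ^ 2 ≤ r ^ (k - 1) * E₀ := by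
    intro k hk t ht
    exact normSq_le_geometric_mixedDrainPair hu hv hε hder h2 h3 hreg ht
      (fun n hn τ hτ => (hsign n hn τ ⟨hτ.1, lt_of_le_of_lt hτ.2 ht.2⟩).1)
      (fun n hn τ hτ => (hsign n hn τ ⟨hτ.1, lt_of_le_of_lt hτ.2 ht.2⟩).2) hk
  -- `Λ² r < 1`
  have hL : 0 < bigLam ε₀ := bigLam_pos (by linarith)
  have hL2 : bigLam ε₀ ^ 2 = (1 + ε₀) ^ 5 := by
    unfold bigLam
    rw [← Real.rpow_natCast, ← Real.rpow_mul (by linarith)]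
    norm_num
  have hqr : bigLam ε₀ ^ 2 * r < 1 := by
    rw [hL2, hr, ← div_eq_mul_inv, div_lt_one hq]
    exact hth
  have hqr0 : 0 ≤ bigLam ε₀ ^ 2 * r := by positivity
  -- the constant `K₀ = (C_A T)² Λ⁴ E₀` and a shell `k` with `K₀ (Λ² r)^{k-1} < 1`
  set K₀ : ℝ := (fluxConst (fun (i₁ i₂ i₃ : Fin 4) (μ : ℤ × ℤ × ℤ) => if μ = ((0 : ℤ), (0 : ℤ), (1 : ℤ)) then
        (if (i₁ = 0 ∧ i₂ = 1) ∨ (i₁ = 1 ∧ i₂ = 0) then (if i₃ = 0 then u else if i₃ = 1 then v else 0) else 0)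
      else if μ = ((1 : ℤ), (0 : ℤ), (0 : ℤ)) then
        (if i₁ = 0 ∧ i₂ = 1 ∧ i₃ = 0 then -u else if i₁ = 1 ∧ i₂ = 1 ∧ i₃ = 0 then -v else 0)
      else if μ = ((0 : ℤ), (1 : ℤ), (0 : ℤ)) then
        (if i₁ = 1 ∧ i₂ = 0 ∧ i₃ = 0 then -u else if i₁ = 1 ∧ i₂ = 1 ∧ i₃ = 0 then -v else 0) else 0) * T) ^ 2 * (bigLam ε₀ ^ 2) ^ 2 * E₀ with hK₀
  have hK₀nn : 0 ≤ K₀ := by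
    have : 0 ≤ E₀ := Finset.sum_nonneg fun i _ => sq_nonneg _
    positivity
  obtain ⟨N, hN⟩ := exists_pow_lt_of_lt_one (show 0 < (K₀ + 1)⁻¹ by positivity) hqr
  have hsmall : K₀ * (bigLam ε₀ ^ 2 * r) ^ N < 1 := by
    calc K₀ * (bigLam ε₀ ^ 2 * r) ^ N ≤ K₀ * (K₀ + 1)⁻¹ :=
          mul_le_mul_of_nonneg_left hN.le hK₀nn
      _ < 1 := by rw [← div_eq_mul_inv, div_lt_one (by positivity)]; linarith
  -- shell `N + 1` fires: contradiction
  obtain ⟨t, ht0, htT, hlt⟩ := hfire (N + 1)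
  have hxk := hprof (N + 1) (by omega) t ⟨ht0, htT⟩
  rw [Nat.add_sub_cancel] at hxk
  have hpos : 0 < fluxConst (fun (i₁ i₂ i₃ : Fin 4) (μ : ℤ × ℤ × ℤ) => if μ = ((0 : ℤ), (0 : ℤ), (1 : ℤ)) then
        (if (i₁ = 0 ∧ i₂ = 1) ∨ (i₁ = 1 ∧ i₂ = 0) then (if i₃ = 0 then u else if i₃ = 1 then v else 0) else 0)
      else if μ = ((1 : ℤ), (0 : ℤ), (0 : ℤ)) then
        (if i₁ = 0 ∧ i₂ = 1 ∧ i₃ = 0 then -u else if i₁ = 1 ∧ i₂ = 1 ∧ i₃ = 0 then -v else 0)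
      else if μ = ((0 : ℤ), (1 : ℤ), (0 : ℤ)) then
        (if i₁ = 1 ∧ i₂ = 0 ∧ i₃ = 0 then -u else if i₁ = 1 ∧ i₂ = 1 ∧ i₃ = 0 then -v else 0) else 0) * T * bigLam ε₀ ^ (N + 1 + 1) * ‖shellVec X ((N + 1 : ℕ) : ℤ) t‖ :=
    lt_trans zero_lt_one hlt
  have hsq : 1 < (fluxConst (fun (i₁ i₂ i₃ : Fin 4) (μ : ℤ × ℤ × ℤ) => if μ = ((0 : ℤ), (0 : ℤ), (1 : ℤ)) then
        (if (i₁ = 0 ∧ i₂ = 1) ∨ (i₁ = 1 ∧ i₂ = 0) then (if i₃ = 0 then u else if i₃ = 1 then v else 0) else 0)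
      else if μ = ((1 : ℤ), (0 : ℤ), (0 : ℤ)) then
        (if i₁ = 0 ∧ i₂ = 1 ∧ i₃ = 0 then -u else if i₁ = 1 ∧ i₂ = 1 ∧ i₃ = 0 then -v else 0)
      else if μ = ((0 : ℤ), (1 : ℤ), (0 : ℤ)) then
        (if i₁ = 1 ∧ i₂ = 0 ∧ i₃ = 0 then -u else if i₁ = 1 ∧ i₂ = 1 ∧ i₃ = 0 then -v else 0) else 0) * T * bigLam ε₀ ^ (N + 1 + 1) * ‖shellVec X ((N + 1 : ℕ) : ℤ) t‖) ^ 2 := by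
    nlinarith
  have hbound : (fluxConst (fun (i₁ i₂ i₃ : Fin 4) (μ : ℤ × ℤ × ℤ) => if μ = ((0 : ℤ), (0 : ℤ), (1 : ℤ)) then
        (if (i₁ = 0 ∧ i₂ = 1) ∨ (i₁ = 1 ∧ i₂ = 0) then (if i₃ = 0 then u else if i₃ = 1 then v else 0) else 0)
      else if μ = ((1 : ℤ), (0 : ℤ), (0 : ℤ)) then
        (if i₁ = 0 ∧ i₂ = 1 ∧ i₃ = 0 then -u else if i₁ = 1 ∧ i₂ = 1 ∧ i₃ = 0 then -v else 0)
      else if μ = ((0 : ℤ), (1 : ℤ), (0 : ℤ)) then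
        (if i₁ = 1 ∧ i₂ = 0 ∧ i₃ = 0 then -u else if i₁ = 1 ∧ i₂ = 1 ∧ i₃ = 0 then -v else 0) else 0) * T * bigLam ε₀ ^ (N + 1 + 1) * ‖shellVec X ((N + 1 : ℕ) : ℤ) t‖) ^ 2 ≤
      K₀ * (bigLam ε₀ ^ 2 * r) ^ N := by
    have hcoef : 0 ≤ (fluxConst (fun (i₁ i₂ i₃ : Fin 4) (μ : ℤ × ℤ × ℤ) => if μ = ((0 : ℤ), (0 : ℤ), (1 : ℤ)) then
        (if (i₁ = 0 ∧ i₂ = 1) ∨ (i₁ = 1 ∧ i₂ = 0) then (if i₃ = 0 then u else if i₃ = 1 then v else 0) else 0)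
      else if μ = ((1 : ℤ), (0 : ℤ), (0 : ℤ)) then
        (if i₁ = 0 ∧ i₂ = 1 ∧ i₃ = 0 then -u else if i₁ = 1 ∧ i₂ = 1 ∧ i₃ = 0 then -v else 0)
      else if μ = ((0 : ℤ), (1 : ℤ), (0 : ℤ)) then
        (if i₁ = 1 ∧ i₂ = 0 ∧ i₃ = 0 then -u else if i₁ = 1 ∧ i₂ = 1 ∧ i₃ = 0 then -v else 0) else 0) * T * bigLam ε₀ ^ (N + 1 + 1)) ^ 2 := sq_nonneg _
    calc (fluxConst (fun (i₁ i₂ i₃ : Fin 4) (μ : ℤ × ℤ × ℤ) => if μ = ((0 : ℤ), (0 : ℤ), (1 : ℤ)) then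
        (if (i₁ = 0 ∧ i₂ = 1) ∨ (i₁ = 1 ∧ i₂ = 0) then (if i₃ = 0 then u else if i₃ = 1 then v else 0) else 0)
      else if μ = ((1 : ℤ), (0 : ℤ), (0 : ℤ)) then
        (if i₁ = 0 ∧ i₂ = 1 ∧ i₃ = 0 then -u else if i₁ = 1 ∧ i₂ = 1 ∧ i₃ = 0 then -v else 0)
      else if μ = ((0 : ℤ), (1 : ℤ), (0 : ℤ)) then
        (if i₁ = 1 ∧ i₂ = 0 ∧ i₃ = 0 then -u else if i₁ = 1 ∧ i₂ = 1 ∧ i₃ = 0 then -v else 0) else 0) * T * bigLam ε₀ ^ (N + 1 + 1) * ‖shellVec X ((N + 1 : ℕ) : ℤ) t‖) ^ 2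
        = (fluxConst (fun (i₁ i₂ i₃ : Fin 4) (μ : ℤ × ℤ × ℤ) => if μ = ((0 : ℤ), (0 : ℤ), (1 : ℤ)) then
        (if (i₁ = 0 ∧ i₂ = 1) ∨ (i₁ = 1 ∧ i₂ = 0) then (if i₃ = 0 then u else if i₃ = 1 then v else 0) else 0)
      else if μ = ((1 : ℤ), (0 : ℤ), (0 : ℤ)) then
        (if i₁ = 0 ∧ i₂ = 1 ∧ i₃ = 0 then -u else if i₁ = 1 ∧ i₂ = 1 ∧ i₃ = 0 then -v else 0)
      else if μ = ((0 : ℤ), (1 : ℤ), (0 : ℤ)) then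
        (if i₁ = 1 ∧ i₂ = 0 ∧ i₃ = 0 then -u else if i₁ = 1 ∧ i₂ = 1 ∧ i₃ = 0 then -v else 0) else 0) * T * bigLam ε₀ ^ (N + 1 + 1)) ^ 2 * ‖shellVec X ((N + 1 : ℕ) : ℤ) t‖ ^ 2 := by ring
      _ ≤ (fluxConst (fun (i₁ i₂ i₃ : Fin 4) (μ : ℤ × ℤ × ℤ) => if μ = ((0 : ℤ), (0 : ℤ), (1 : ℤ)) then
        (if (i₁ = 0 ∧ i₂ = 1) ∨ (i₁ = 1 ∧ i₂ = 0) then (if i₃ = 0 then u else if i₃ = 1 then v else 0) else 0)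
      else if μ = ((1 : ℤ), (0 : ℤ), (0 : ℤ)) then
        (if i₁ = 0 ∧ i₂ = 1 ∧ i₃ = 0 then -u else if i₁ = 1 ∧ i₂ = 1 ∧ i₃ = 0 then -v else 0)
      else if μ = ((0 : ℤ), (1 : ℤ), (0 : ℤ)) then
        (if i₁ = 1 ∧ i₂ = 0 ∧ i₃ = 0 then -u else if i₁ = 1 ∧ i₂ = 1 ∧ i₃ = 0 then -v else 0) else 0) * T * bigLam ε₀ ^ (N + 1 + 1)) ^ 2 * (r ^ N * E₀) :=
          mul_le_mul_of_nonneg_left hxk hcoef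
      _ = K₀ * (bigLam ε₀ ^ 2 * r) ^ N := by rw [hK₀]; ring
  linarith

end BlowupRigidityOne

end Summit.NavierStokesRegularity.NavierStokesRegularity.Theorems

end
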